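import Summits.Langlands.Langlands.Theses.AbelianSurfaceSerre
import Literature.NumberTheory.PAdicHodge.FontaineDpst
import Literature.NumberTheory.PAdicHodge.FontaineDpstUnconditional

/-!
# `SerreGSp4Surjective` (stmt-Langlands-17765) — Negative knowledge I: the void-anchor engine
# `FontaineVoidBorel ℓ` of the picked line `Sketch` is FALSE as typed (every odd prime `ℓ`)

From the standing disprover's `Cruxes/SerreGSp4Surjective/Disproof.lean` (cdisprove gen 1, cycle 1,
2026-08-17). The crux itself (Serre's conjecture for `GSp₄/ℚ` in regular ordinary weight, full
image) is NOT refuted. This file lands a kernel-checked kill of stub 3/7 of the lead's picked line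
`Lines/Sketch.lean` (`stub_fontaineVoidBorel : FontaineVoidBorel 7`), on which stub 5/7
(`stub_levelOne_of … (hvoid : FontaineVoidBorel 7) …`) rests — so that stub 5 is provable VACUOUSLY
and the line's decomposition of `LevelOneSerre` carries no content until the engine is re-typed.

`FontaineVoidBorel ℓ` (verbatim below, inlined — the `Cruxes/` workfile is not importable here) says:
every `r : Γ_ℚ →ₜ* GL₄(ℚ̄_ℓ)` that is symplectic (some multiplier), unramified outside `ℓ`, and at
`v ∣ ℓ` crystalline with Hodge–Tate weights in `[0,3]` for the PINNED datum
`fontainePstAdicCompletion v ℓ hv`, is residually cyclotomic-Borel with INJECTIVE exponents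
`a : Fin 4 → ℕ`, `a i ≤ 3` (i.e. `r̄^ss ≅ ⊕ᵢ ε̄_ℓ^{a i}`, `a` a permutation of `(0,1,2,3)`) and
crystalline-ordinary of shape `(0,1,2,3)` at `ℓ`.

WITNESS: the trivial representation `r = 1`. It is symplectic with multiplier `1` (standard
alternating Gram matrix), unramified everywhere (`1 σ = 1`), and at `v ∣ ℓ` its restriction is
locally unramified, hence crystalline for EVERY `PstWeilDeligneData` (structure axioms,
`isCrystallineFramed_of_isLocallyUnramified`) and de Rham with all Hodge–Tate weights `0 ∈ [0,3]`
for THE datum UNCONDITIONALLY (`fontainePstAdicCompletion_unramifiedWeightsZero`, no appeal to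
`FontaineDatumExists`). But its characteristic polynomials are `(X-1)⁴`, so
`∏ᵢ (X - ε̄_ℓ(g)^{a i}) = (X-1)⁴` in `𝔽̄_ℓ[X]` for all `g`; some `a i = 1`, whence `ε̄_ℓ(g) = 1` for
all `g ∈ Γ_ℚ` — contradicting the non-triviality of the mod-`ℓ` cyclotomic character of `ℚ` for odd
`ℓ` (`exists_modPCyclotomicCharacterZMod_rat_ne_one`: a `Γ_ℚ`-fixed primitive `ℓ`-th root of unity
in `ℚ̄` would be rational, infinite Galois theory `InfiniteGalois.mem_range_algebraMap_iff_fixed`,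
and `q ^ ℓ = 1 ⇒ q = 1` in `ℚ` for odd `ℓ`).

WHY IT IS MISSTATED, and the repair the lead should NOT stop at: the printed void (Fontaine 1993,
Abrashkin 1989) gives `r^ss ≅ ⊕ ℚ_ℓ(-kᵢ)` with `kᵢ ∈ [0,3]` — NOT with the `kᵢ` distinct; weights in
`[0,3]` (`IsDeRhamWithWeightsIn 0 3`) do not force the regular parallel weight `{0,1,2,3}` the card
has in mind, so "injective `a`" needs the extra hypothesis "HT weights exactly `{0,1,2,3}`". EVEN
THEN the conclusion is inconsistent as typed: `IsCrystallineOrdinaryOfShapeAt v ![0,1,2,3]` puts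
`ε^0, ε^{-1}, ε^{-2}, ε^{-3}` on the inertial diagonal (tree convention `HT(ε) = -1`), so
`r̄|_{I_ℓ}^ss ≅ 1 ⊕ ε̄^{-1} ⊕ ε̄^{-2} ⊕ ε̄^{-3}`, exponents `{0,-1,-2,-3} ≡ {0, ℓ-2, ℓ-3, ℓ-4}`, while
`IsResiduallyCyclotomicBorel ℓ r a` with `a i ≤ 3` injective demands exponents `{0,1,2,3}`; for
`ℓ = 7` these are `{0,5,4,3} ≠ {0,1,2,3}` (mod 6) — the two conjuncts of the conclusion contradict
each other on the motivating example `ℚ_ℓ ⊕ ℚ_ℓ(-1) ⊕ ℚ_ℓ(-2) ⊕ ℚ_ℓ(-3)` (paper; its crystallinity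
for the pinned datum is not derivable from the current specification, so that second witness is not
formalised). Corrected signature (suggestion): hypothesis "labelled HT weights of `r.toLocal v` are
exactly `{0,1,2,3}`", conclusion `IsResiduallyCyclotomicBorel` with exponents `ε̄(g)⁻¹ ^ (a i)`
(or `a i` replaced by `(ℓ - 1) - a i`), `a = ![0,1,2,3] ∘ σ` — and the SAME sign fix in
`BorelSkinnerWilesGSp4`'s residual hypothesis if it is to be fed by the void.

Contents: `stub_fontaineVoidBorel_false` (all odd `ℓ`; instantiate at `7`, or at `5` for
ideator-1's `void-at-five`), the witness lemmas for `r = 1`, and the non-triviality of `ε̄_ℓ` on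
`Γ_ℚ` (general perfect-field form `exists_modPCyclotomicCharacterZMod_ne_one_of`). Mathlib + the
route file + `FontaineDpst(Unconditional)`. [folklore]
-/

set_option linter.dupNamespace false

namespace Summit.Langlands.Langlands.Theorems.SerreGSp4Surjective.Negative

open Literature.NumberTheory.GaloisRepresentations Literature.NumberTheory.Automorphic
  Literature.NumberTheory.PAdicHodge
open scoped NumberField
open IsDedekindDomain Polynomial

/-! ### Non-triviality of the mod-`p` cyclotomic character -/

/-- **The mod-`p` cyclotomic character of a field with no non-trivial `p`-th roots of unity is
non-trivial** (`K` of characteristic `0`): if `χ̄_p(σ) = 1` for all `σ ∈ Γ_K`, a primitive `p`-th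
root of unity `ζ ∈ K̄` is `Γ_K`-fixed, hence lies in `K` (infinite Galois theory, `K̄/K` Galois), so
`ζ = 1` by hypothesis — absurd. [folklore] -/
theorem exists_modPCyclotomicCharacterZMod_ne_one_of (K : Type*) [Field K] [CharZero K]
    (p : ℕ) [Fact p.Prime] [NeZero (p : K)] (hK : ∀ q : K, q ^ p = 1 → q = 1) :
    ∃ g : Field.absoluteGaloisGroup K, modPCyclotomicCharacterZMod K p g ≠ 1 := by
  by_contra h
  push Not at h
  obtain ⟨ζ, hζ⟩ := HasEnoughRootsOfUnity.exists_primitiveRoot (AlgebraicClosure K) p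
  have hfix : ∀ f : AlgebraicClosure K ≃ₐ[K] AlgebraicClosure K, f ζ = ζ := by
    intro f
    have := modPCyclotomicCharacterZMod_spec K p ((Field.absoluteGaloisGroup.toAlgEquiv K).symm f)
      ζ hζ.pow_eq_one
    rw [h _, Field.absoluteGaloisGroup.toAlgEquiv_symm_apply] at this
    have h1 : (((1 : (ZMod p)ˣ) : ZMod p)).val = 1 := by
      rw [Units.val_one, ZMod.val_one]
    rw [h1, pow_one] at this
    exact this
  obtain ⟨q, hq⟩ := (InfiniteGalois.mem_range_algebraMap_iff_fixed (k := K) ζ).mpr hfix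
  have hq1 : q ^ p = 1 := by
    have : (algebraMap K (AlgebraicClosure K)) (q ^ p) = algebraMap K _ 1 := by
      rw [map_pow, hq, hζ.pow_eq_one, map_one]
    exact (algebraMap K (AlgebraicClosure K)).injective this
  have : ζ = 1 := by rw [← hq, hK q hq1, map_one]
  exact hζ.ne_one (Fact.out : p.Prime).one_lt this

/-- **Over `ℚ` the mod-`p` cyclotomic character is non-trivial for every odd prime `p`**
(`q ^ p = 1 ⇒ q = 1` in `ℚ`, odd powers being strictly monotone). [folklore] -/
theorem exists_modPCyclotomicCharacterZMod_rat_ne_one (p : ℕ) [Fact p.Prime] (hp : p ≠ 2) :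
    ∃ g : Field.absoluteGaloisGroup ℚ, modPCyclotomicCharacterZMod ℚ p g ≠ 1 := by
  refine exists_modPCyclotomicCharacterZMod_ne_one_of ℚ p fun q hq => ?_
  have hodd : Odd p := (Fact.out : p.Prime).odd_of_ne_two hp
  exact (hodd.strictMono_pow (R := ℚ)).injective (by simpa using hq)

/-! ### The witness: the trivial representation `1 : Γ_ℚ →ₜ* GL₄(ℚ̄_ℓ)` -/

section Witness

variable (ℓ : ℕ) [Fact ℓ.Prime]

/-- The standard alternating Gram matrix `J` on `R⁴` is skew: `Jᵀ = -J`. [folklore] -/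
theorem stdGram_transpose (R : Type*) [CommRing R] :
    (!![0, 0, 0, 1; 0, 0, 1, 0; 0, -1, 0, 0; -1, 0, 0, 0] : Matrix (Fin 4) (Fin 4) R).transpose =
      -!![0, 0, 0, 1; 0, 0, 1, 0; 0, -1, 0, 0; -1, 0, 0, 0] := by
  ext i j; fin_cases i <;> fin_cases j <;> simp

/-- `J² = -1` for the standard alternating Gram matrix. [folklore] -/
theorem stdGram_mul_self (R : Type*) [CommRing R] :
    (!![0, 0, 0, 1; 0, 0, 1, 0; 0, -1, 0, 0; -1, 0, 0, 0] : Matrix (Fin 4) (Fin 4) R) *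
        !![0, 0, 0, 1; 0, 0, 1, 0; 0, -1, 0, 0; -1, 0, 0, 0] = -1 := by
  ext i j
  fin_cases i <;> fin_cases j <;> simp [Matrix.mul_apply, Fin.sum_univ_four]

/-- The standard alternating Gram matrix is non-degenerate (`det J · det J = det(-1) = 1`). [folklore] -/
theorem isUnit_det_stdGram (R : Type*) [CommRing R] :
    IsUnit (!![0, 0, 0, 1; 0, 0, 1, 0; 0, -1, 0, 0; -1, 0, 0, 0] : Matrix (Fin 4) (Fin 4) R).det := by
  have h : (!![0, 0, 0, 1; 0, 0, 1, 0; 0, -1, 0, 0; -1, 0, 0, 0] : Matrix (Fin 4) (Fin 4) R).det *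
      (!![0, 0, 0, 1; 0, 0, 1, 0; 0, -1, 0, 0; -1, 0, 0, 0] : Matrix (Fin 4) (Fin 4) R).det = 1 := by
    rw [← Matrix.det_mul, stdGram_mul_self, Matrix.det_neg, Matrix.det_one]
    norm_num [Fintype.card_fin]
  exact isUnit_iff_exists_inv.mpr ⟨_, h⟩

/-- The trivial framed representation has value the identity matrix. [folklore] -/
theorem one_apply_val (g : Field.absoluteGaloisGroup ℚ) :
    ((1 : FramedGaloisRep ℚ (PadicAlgCl ℓ) 4) g).val = 1 := rfl

/-- **The trivial representation is symplectic** (multiplier `1`, standard Gram matrix). [folklore] -/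
theorem one_isSymplecticWithMultiplierFun :
    (1 : FramedGaloisRep ℚ (PadicAlgCl ℓ) 4).IsSymplecticWithMultiplierFun (fun _ => 1) := by
  refine ⟨_, stdGram_transpose _, isUnit_det_stdGram _, fun g => ?_⟩
  rw [one_apply_val, Matrix.transpose_one, one_mul, mul_one, one_smul]

/-- The trivial representation is unramified at every finite place. [folklore] -/
theorem one_isUnramifiedAt (v : HeightOneSpectrum (𝓞 ℚ)) :
    (1 : FramedGaloisRep ℚ (PadicAlgCl ℓ) 4).IsUnramifiedAt v :=
  fun _ _ _ _ => rfl

/-- The restriction of the trivial representation to a decomposition group is locally unramified. [folklore] -/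
theorem one_toLocal_isLocallyUnramified (v : HeightOneSpectrum (𝓞 ℚ)) :
    ((1 : FramedGaloisRep ℚ (PadicAlgCl ℓ) 4).toLocal v).IsLocallyUnramified :=
  fun σ _ => by rw [FramedGaloisRep.toLocal_apply]; rfl

/-- **At `v ∣ ℓ` the trivial representation is crystalline and de Rham with weights in `[0,3]` for
the PINNED datum — unconditionally** (crystalline: structure axioms of `PstWeilDeligneData`; weights
`0`: `fontainePst_unramifiedWeightsZero`, a theorem about THE datum's period ring `B_dR`). [folklore] -/
theorem one_isCrystallineFramed_and_weights (v : HeightOneSpectrum (𝓞 ℚ))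
    (hv : ((ℓ : ℕ) : 𝓞 ℚ) ∈ v.asIdeal) :
    (fontainePstAdicCompletion v ℓ hv).IsCrystallineFramed
        ((1 : FramedGaloisRep ℚ (PadicAlgCl ℓ) 4).toLocal v) ∧
      (fontainePstAdicCompletion v ℓ hv).IsDeRhamWithWeightsIn 0 3
        ((1 : FramedGaloisRep ℚ (PadicAlgCl ℓ) 4).toLocal v) :=
  ⟨PstWeilDeligneData.isCrystallineFramed_of_isLocallyUnramified _
      (one_toLocal_isLocallyUnramified ℓ v),
    (fontainePstAdicCompletion_unramifiedWeightsZero v ℓ hv _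
      (one_toLocal_isLocallyUnramified ℓ v)).mono le_rfl (by norm_num)⟩

/-- The characteristic polynomials of the trivial rank-`4` representation are `(X - 1)⁴`. [folklore] -/
theorem charpoly_one_eq (g : Field.absoluteGaloisGroup ℚ) :
    FramedRep.charpoly (1 : FramedGaloisRep ℚ (PadicAlgCl ℓ) 4) g = (X - 1) ^ 4 := by
  rw [FramedRep.charpoly, one_apply_val, Matrix.charpoly_one, Fintype.card_fin]

end Witness

/-! ### The kill -/

/-- **`stub_fontaineVoidBorel` of line `Sketch` is false for every odd prime `ℓ`** (in particular
at the line's `ℓ = 7` and at `ℓ = 5`). The negated statement is `Sketch.FontaineVoidBorel ℓ`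
VERBATIM (with `Sketch.IsResiduallyCyclotomicBorel` inlined), so
`example : ¬ Sketch.FontaineVoidBorel 7 := stub_fontaineVoidBorel_false 7 (by decide)` closes by
`Iff.rfl`-unfolding in the line file. Witness `r = 1`; see the module docstring for the argument
and for why the natural repair (regular weights) is still inconsistent as typed (exponent sign). [folklore] -/
theorem stub_fontaineVoidBorel_false (ℓ : ℕ) [Fact ℓ.Prime] (hℓ : ℓ ≠ 2) :
    ¬ (∀ r : FramedGaloisRep ℚ (PadicAlgCl ℓ) 4,
        (∃ ν : Field.absoluteGaloisGroup ℚ → PadicAlgCl ℓ, r.IsSymplecticWithMultiplierFun ν) →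
        (∀ v : HeightOneSpectrum (𝓞 ℚ), ((ℓ : ℕ) : 𝓞 ℚ) ∉ v.asIdeal → r.IsUnramifiedAt v) →
        (∀ (v : HeightOneSpectrum (𝓞 ℚ)) (hv : ((ℓ : ℕ) : 𝓞 ℚ) ∈ v.asIdeal),
          (fontainePstAdicCompletion v ℓ hv).IsCrystallineFramed (r.toLocal v) ∧
            (fontainePstAdicCompletion v ℓ hv).IsDeRhamWithWeightsIn 0 3 (r.toLocal v)) →
        ∃ a : Fin 4 → ℕ, Function.Injective a ∧ (∀ i, a i ≤ 3) ∧
          (∃ red : (Valued.v : Valuation (PadicAlgCl ℓ) NNReal).valuationSubring →+*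
              AlgebraicClosure (ZMod ℓ),
            ∀ g : Field.absoluteGaloisGroup ℚ,
              ∃ P : Polynomial (Valued.v : Valuation (PadicAlgCl ℓ) NNReal).valuationSubring,
                P.map (Valued.v : Valuation (PadicAlgCl ℓ) NNReal).valuationSubring.subtype =
                    FramedRep.charpoly r g ∧
                  P.map red = ∏ i : Fin 4,
                    (X - C (algebraMap (ZMod ℓ) (AlgebraicClosure (ZMod ℓ))
                      (((modPCyclotomicCharacterZMod ℚ ℓ g : (ZMod ℓ)ˣ) : ZMod ℓ) ^ a i)))) ∧
          ∀ v : HeightOneSpectrum (𝓞 ℚ), ((ℓ : ℕ) : 𝓞 ℚ) ∈ v.asIdeal →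
            r.IsCrystallineOrdinaryOfShapeAt v ![0, 1, 2, 3]) := by
  intro h
  obtain ⟨a, ha_inj, ha_le, ⟨red, hred⟩, -⟩ :=
    h 1 ⟨_, one_isSymplecticWithMultiplierFun ℓ⟩ (fun v _ => one_isUnramifiedAt ℓ v)
      (one_isCrystallineFramed_and_weights ℓ)
  obtain ⟨g, hg⟩ := exists_modPCyclotomicCharacterZMod_rat_ne_one ℓ hℓ
  obtain ⟨P, hP1, hP2⟩ := hred g
  have hP : P = (X - 1) ^ 4 := by
    apply Polynomial.map_injective (Valued.v : Valuation (PadicAlgCl ℓ) NNReal).valuationSubring.subtype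
      Subtype.val_injective
    rw [hP1, charpoly_one_eq]
    simp [Polynomial.map_sub, Polynomial.map_pow]
  rw [hP] at hP2
  have hlhs : ((X - 1 :
      Polynomial (Valued.v : Valuation (PadicAlgCl ℓ) NNReal).valuationSubring) ^ 4).map red =
      (X - 1) ^ 4 := by
    simp [Polynomial.map_sub, Polynomial.map_pow]
  obtain ⟨i, hi⟩ : ∃ i, a i = 1 := by
    have hinj : Function.Injective
        (fun i : Fin 4 => (⟨a i, Nat.lt_succ_of_le (ha_le i)⟩ : Fin 4)) := by
      intro i j hij
      exact ha_inj (by simpa using congrArg Fin.val hij)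
    have hsurj : Function.Surjective _ := Finite.injective_iff_surjective.mp hinj
    obtain ⟨i, hi⟩ := hsurj 1
    exact ⟨i, by simpa using congrArg Fin.val hi⟩
  set c : AlgebraicClosure (ZMod ℓ) := algebraMap (ZMod ℓ) (AlgebraicClosure (ZMod ℓ))
    (((modPCyclotomicCharacterZMod ℚ ℓ g : (ZMod ℓ)ˣ) : ZMod ℓ)) with hc
  have hroot : ((X - 1 : (AlgebraicClosure (ZMod ℓ))[X]) ^ 4).eval c = 0 := by
    rw [← hlhs, hP2, Polynomial.eval_prod]
    exact Finset.prod_eq_zero (Finset.mem_univ i) (by simp [hi, hc])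
  have hc1 : c = 1 := by
    simpa [sub_eq_zero] using hroot
  apply hg
  ext
  rw [Units.val_one]
  exact (algebraMap (ZMod ℓ) (AlgebraicClosure (ZMod ℓ))).injective (by rw [map_one]; exact hc1)

end Summit.Langlands.Langlands.Theorems.SerreGSp4Surjective.Negative
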